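import Summits.ResolutionOfSingularities.ResolutionOfSingularities.Theorems.HomologicalConductorNoZenoBirthDefs
import Summits.ResolutionOfSingularities.ResolutionOfSingularities.Theorems.HomologicalConductorNoZenoNoetherianCase
import Summits.ResolutionOfSingularities.ResolutionOfSingularities.Theorems.HomologicalConductorNoZenoTowerNoetherian
import Summits.ResolutionOfSingularities.ResolutionOfSingularities.Theorems.HomologicalConductorNoZenoIffKernel
import Summits.ResolutionOfSingularities.ResolutionOfSingularities.Theorems.HomologicalConductorNoZenoDim2RegularCentre
import Summits.ResolutionOfSingularities.ResolutionOfSingularities.Theorems.HomologicalConductorSurfaceTerminationRegimes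
import Summits.ResolutionOfSingularities.ResolutionOfSingularities.Theorems.HomologicalConductorStrictDropTowerShape
import Summits.ResolutionOfSingularities.ResolutionOfSingularities.Theorems.SyzygyFlatteningHigherRankTerminationLocAt
import Literature.RingTheory.CohomologyAnnihilator.Localization
import Literature.AlgebraicGeometry.Resolution.TranscendenceDefect
import HarnessLib

/-!
# Crux `NoZeno` (stmt-ResolutionOfSingularities-16483), line `birth`: re-basing the tower to `k(s)` — WLOG zero-dimensional stages

The canonical normalised `ca`-tower `T_m = tower O A m` (`Theorems/HomologicalConductorNoZenoBirthDefs.lean`)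
depends on the ground field `k` only through the words "`k`-subalgebra generated by": `ca` is an
invariant of the ring `T_m`, and `loc`, `chart`, `nrm` adjoin sets that already contain the stage.
Hence (§1) re-basing a stage to an intermediate field `F` (`k ⊆ F ⊆ T_m`) does not change the
carriers of any later stage (`rb_tower_toSubring_eq`), and the tower restarted at a stage is the
shifted tower (`tower_tower`). Consequence (file `HomologicalConductorNoZenoRebaseInduction.lean`,
`exists_regular_of_residually_transcendental_mem_tower_of_IH`): if some stage `T_m` contains an
element `s` whose residue in `κ(O)` is transcendental over `k`, then `k(s) ⊆ T_m`, the tower from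
stage `m` on is the `k(s)`-tower of a finitely generated `k(s)`-model of `T_m`, and
`tr.deg_{k(s)} K < tr.deg_k K`; so **by induction on the transcendence degree** (the route cruxes
`Persistence`/`StrictDrop` being universal over all fields of characteristic `p`) such towers
terminate. For the trdeg-≥-3 stubs of the line (`stub_kernelRankOneHigh`,
`stub_kernelCompositeHighDim`) this is the free normalisation «every stage is zero-dimensional over
`k`» (KERNEL-L0 §8); in trdeg 2 it is the residual criterion
(`Theorems/HomologicalConductorSurfaceTerminationResidualCriterion.lean`) with the curve case as
the induction base.

References: O. Zariski, P. Samuel, *Commutative Algebra* II, VI §14 [`ZariskiSamuel1960`];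
S. Iyengar, R. Takahashi, IMRN 2016, §2 (invariance of `ca` under ring isomorphism)
[`IyengarTakahashi2014`].
-/

noncomputable section

-- single-problem summit: the doubled namespace component `ResolutionOfSingularities` is forced
set_option linter.dupNamespace false

namespace Summit.ResolutionOfSingularities.ResolutionOfSingularities.Theorems.NoZeno.Birth

open Summit.ResolutionOfSingularities.ResolutionOfSingularities.Theses.HomologicalConductor
open Literature.AlgebraicGeometry.Resolution Literature.RingTheory.CohomologyAnnihilator Polynomial

variable {k K : Type} [Field k] [Field K] [Algebra k K]

/-! ## §1 Re-basing: carriers of `ca`, `loc`, `chart`, `nrm`, `tower` do not see the ground field -/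

section Rebase

variable (F : IntermediateField k K)

/-- Adjoining a set `S` over `k` or over an intermediate field `F` gives the same subring, as soon
as (the images of) `k` and `F` lie in the subring generated by `S`. [folklore] -/
theorem rb_adjoin_toSubring_eq (S : Set K)
    (hkS : Set.range (algebraMap k K) ⊆ (Subring.closure S : Set K))
    (hFS : Set.range (algebraMap (↥F) K) ⊆ (Subring.closure S : Set K)) :
    (Algebra.adjoin (↥F) S).toSubring = (Algebra.adjoin k S).toSubring := by
  rw [Algebra.adjoin_eq_ring_closure, Algebra.adjoin_eq_ring_closure]
  have h1 : Subring.closure (Set.range (algebraMap (↥F) K) ∪ S) = Subring.closure S :=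
    le_antisymm (Subring.closure_le.mpr (Set.union_subset hFS Subring.subset_closure))
      (Subring.closure_mono Set.subset_union_right)
  have h2 : Subring.closure (Set.range (algebraMap k K) ∪ S) = Subring.closure S :=
    le_antisymm (Subring.closure_le.mpr (Set.union_subset hkS Subring.subset_closure))
      (Subring.closure_mono Set.subset_union_right)
  rw [h1, h2]

variable {F}

/-- `ca` is an invariant of the underlying subring: a `k`-subalgebra and an `F`-subalgebra with the
same carrier have the same `ca` (transport of the cohomology annihilator along the tautological
ring isomorphism, tree `ringEquiv_apply_mem_cohomologyAnnihilatorOfDegree`).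
[cite: IyengarTakahashi2014, Definition 2.1] -/
theorem rb_ca_eq (B : Subalgebra k K) (B'' : Subalgebra (↥F) K)
    (h : B''.toSubring = B.toSubring) : ca B'' = ca B := by
  have hmem : ∀ x : K, x ∈ B'' ↔ x ∈ B := fun x => by
    change x ∈ B''.toSubring ↔ x ∈ B.toSubring
    rw [h]
  let e : ↥B'' ≃+* ↥B := RingEquiv.subringCongr h
  ext x
  constructor
  · intro hx
    have hxB'' : x ∈ B'' := ca_subset _ hx
    have hxB : x ∈ B := (hmem x).mp hxB''
    have h1 := (tn_coe_mem_ca_iff B'' ⟨x, hxB''⟩).mp hx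
    rw [mem_cohomologyAnnihilator_iff] at h1
    obtain ⟨n, hn⟩ := h1
    have h2 : e ⟨x, hxB''⟩ ∈ cohomologyAnnihilatorOfDegree ↥B n :=
      ringEquiv_apply_mem_cohomologyAnnihilatorOfDegree e hn
    have h3 : (⟨x, hxB⟩ : ↥B) ∈ cohomologyAnnihilator ↥B :=
      mem_cohomologyAnnihilator_iff.mpr ⟨n, h2⟩
    exact (tn_coe_mem_ca_iff B ⟨x, hxB⟩).mpr h3
  · intro hx
    have hxB : x ∈ B := ca_subset _ hx
    have hxB'' : x ∈ B'' := (hmem x).mpr hxB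
    have h1 := (tn_coe_mem_ca_iff B ⟨x, hxB⟩).mp hx
    rw [mem_cohomologyAnnihilator_iff] at h1
    obtain ⟨n, hn⟩ := h1
    have h2 : e.symm ⟨x, hxB⟩ ∈ cohomologyAnnihilatorOfDegree ↥B'' n :=
      ringEquiv_apply_mem_cohomologyAnnihilatorOfDegree e.symm hn
    have h3 : (⟨x, hxB''⟩ : ↥B'') ∈ cohomologyAnnihilator ↥B'' :=
      mem_cohomologyAnnihilator_iff.mpr ⟨n, h2⟩
    exact (tn_coe_mem_ca_iff B'' ⟨x, hxB''⟩).mpr h3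

/-- Re-basing does not change `loc O ·`. [folklore] -/
theorem rb_loc_toSubring_eq (O : ValuationSubring K) (B : Subalgebra k K)
    (B'' : Subalgebra (↥F) K) (h : B''.toSubring = B.toSubring) :
    (loc O B'').toSubring = (loc O B).toSubring := by
  have hmem : ∀ x : K, x ∈ B'' ↔ x ∈ B := fun x => by
    change x ∈ B''.toSubring ↔ x ∈ B.toSubring
    rw [h]
  have hS : {y : K | ∃ a ∈ B'', ∃ s ∈ B'', s⁻¹ ∈ O ∧ y = a * s⁻¹} =
      {y : K | ∃ a ∈ B, ∃ s ∈ B, s⁻¹ ∈ O ∧ y = a * s⁻¹} := by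
    ext y
    simp only [Set.mem_setOf_eq, hmem]
  have hBS : (B : Set K) ⊆ (Subring.closure
      {y : K | ∃ a ∈ B, ∃ s ∈ B, s⁻¹ ∈ O ∧ y = a * s⁻¹} : Set K) := fun b hb =>
    Subring.subset_closure ⟨b, hb, 1, B.one_mem, by rw [inv_one]; exact O.one_mem,
      by rw [inv_one, mul_one]⟩
  unfold loc
  rw [hS]
  refine rb_adjoin_toSubring_eq F _ ?_ ?_
  · rintro _ ⟨c, rfl⟩; exact hBS (B.algebraMap_mem c)
  · rintro _ ⟨c, rfl⟩; exact hBS ((hmem _).mp (B''.algebraMap_mem c))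

/-- Re-basing does not change `nrm ·` (integrality over a subring depends only on the subring).
[folklore] -/
theorem rb_nrm_toSubring_eq (B : Subalgebra k K) (B'' : Subalgebra (↥F) K)
    (h : B''.toSubring = B.toSubring) : (nrm B'').toSubring = (nrm B).toSubring := by
  have hmem : ∀ x : K, x ∈ B'' ↔ x ∈ B := fun x => by
    change x ∈ B''.toSubring ↔ x ∈ B.toSubring
    rw [h]
  have hS : {y : K | IsIntegral ↥B'' y} = {y : K | IsIntegral ↥B y} := by
    ext y
    change IsIntegral ↥B''.toSubring y ↔ IsIntegral ↥B.toSubring y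
    rw [h]
  have hBS : (B : Set K) ⊆ (Subring.closure {y : K | IsIntegral ↥B y} : Set K) := fun b hb =>
    Subring.subset_closure (isIntegral_algebraMap (R := ↥B) (x := (⟨b, hb⟩ : ↥B)))
  unfold nrm
  rw [hS]
  refine rb_adjoin_toSubring_eq F _ ?_ ?_
  · rintro _ ⟨c, rfl⟩; exact hBS (B.algebraMap_mem c)
  · rintro _ ⟨c, rfl⟩; exact hBS ((hmem _).mp (B''.algebraMap_mem c))

/-- Re-basing does not change `chart O ·`. [folklore] -/
theorem rb_chart_toSubring_eq (O : ValuationSubring K) (B : Subalgebra k K)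
    (B'' : Subalgebra (↥F) K) (h : B''.toSubring = B.toSubring) :
    (chart O B'').toSubring = (chart O B).toSubring := by
  have hmem : ∀ x : K, x ∈ B'' ↔ x ∈ B := fun x => by
    change x ∈ B''.toSubring ↔ x ∈ B.toSubring
    rw [h]
  have hcoe : ((B'' : Set K)) = (B : Set K) := Set.ext hmem
  have hS : ((B'' : Set K) ∪ {y : K | ∃ c ∈ ca B'', ∃ x ∈ ca B'', x ≠ 0 ∧
        (∀ c' ∈ ca B'', c' * x⁻¹ ∈ O) ∧ y = c * x⁻¹}) =
      ((B : Set K) ∪ {y : K | ∃ c ∈ ca B, ∃ x ∈ ca B, x ≠ 0 ∧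
        (∀ c' ∈ ca B, c' * x⁻¹ ∈ O) ∧ y = c * x⁻¹}) := by
    rw [hcoe, rb_ca_eq B B'' h]
  have hBS : (B : Set K) ⊆ (Subring.closure ((B : Set K) ∪ {y : K | ∃ c ∈ ca B, ∃ x ∈ ca B,
      x ≠ 0 ∧ (∀ c' ∈ ca B, c' * x⁻¹ ∈ O) ∧ y = c * x⁻¹}) : Set K) :=
    fun b hb => Subring.subset_closure (Or.inl hb)
  unfold chart
  rw [hS]
  refine rb_adjoin_toSubring_eq F _ ?_ ?_
  · rintro _ ⟨c, rfl⟩; exact hBS (B.algebraMap_mem c)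
  · rintro _ ⟨c, rfl⟩; exact hBS ((hmem _).mp (B''.algebraMap_mem c))

/-- **Re-basing does not change the tower**: if the `F`-subalgebra `A''` and the `k`-subalgebra
`A` have the same carrier, every stage of the `F`-tower of `A''` along `O` has the same carrier as
the corresponding stage of the `k`-tower of `A`. [folklore] -/
theorem rb_tower_toSubring_eq (O : ValuationSubring K) (A : Subalgebra k K)
    (A'' : Subalgebra (↥F) K) (h : A''.toSubring = A.toSubring) (j : ℕ) :
    (tower O A'' j).toSubring = (tower O A j).toSubring := by
  induction j with
  | zero => rw [tower_zero, tower_zero]; exact rb_loc_toSubring_eq O A A'' h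
  | succ j ih =>
    rw [tower_succ, tower_succ]
    exact rb_loc_toSubring_eq O _ _ (rb_nrm_toSubring_eq _ _ (rb_chart_toSubring_eq O _ _ ih))

end Rebase

/-! ## §2 The tower restarted at a stage -/

/-- **The tower restarted at a stage is the shifted tower**: `tower O (T_m) j = T_(m+j)`
(`loc O T_m = T_m`). [folklore] -/
theorem tower_tower (O : ValuationSubring K) (A : Subalgebra k K)
    (hk : ∀ c : k, algebraMap k K c ∈ O) (hAO : A.toSubring ≤ O.toSubring) (m j : ℕ) :
    tower O (tower O A m) j = tower O A (m + j) := by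
  induction j with
  | zero => rw [tower_zero]; exact SurfaceTermination.Regimes.loc_tower O A hk hAO m
  | succ j ih => rw [tower_succ, ih, ← tower_succ]; rfl

end Summit.ResolutionOfSingularities.ResolutionOfSingularities.Theorems.NoZeno.Birth

end
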